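import Summits.CriticalPhenomena.PercolationContinuityZ3.Theorems.PercNearOneGluingAdditiveGluingThreeRelaysOr
import Summits.CriticalPhenomena.PercolationContinuityZ3.Theorems.PercNearOneGluingAdditiveGluingThreeRelaysAssembly
import Summits.CriticalPhenomena.PercolationContinuityZ3.Theorems.PercNearOneGluingAdditiveGluingPartial
import Summits.CriticalPhenomena.PercolationContinuityZ3.Theorems.PercNearOneGluingAdditiveGluingBystanderGoodTwoRelays
import HarnessLib

/-! # Crux `PercNearOneGluing.AdditiveGluing` (stmt-CriticalPhenomena-4576): `AdditiveGluing` for every relay set with at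
# most three relays besides the target, from the OR-lemma

Support file (`--supports stmt-CriticalPhenomena-4576`, deep seat r2).  No definitions, no named facts.  Bookkeeping on top of
`additiveGluing_threeRelays_of_orLemma` (`…ThreeRelaysOr`, the ordered three-relay E-form from the OR-lemma = registered stub
`stub_orLemmaThreeRelays_d2`), exactly parallel to `…ThreeRelaysPsiAssembly` / `…ThreeRelaysAssembly`:
* `threeRelays_eform_of_orLemma`: the E-form for ANY three distinct relays;
* `additiveGluing_of_erase_card_le_three_of_orLemma`: the crux statement for every `A` with `(A.erase b).card ≤ 3`.
So each of the three registered bad-region lemmas — (T1) `stub_regionCertThreeRelays_d2`, (Ψ) `stub_psiCertThreeRelays_d2`,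
(OR) `stub_orLemmaThreeRelays_d2` — closes `AdditiveGluing` for up to three relays.
[cite: KozmaNitzan2024, Theorem 2 (§3.2, pp. 8–9), Lemma 3(i) (p. 6), Conjecture 1 (p. 3)]
-/

namespace Summit.CriticalPhenomena.PercolationContinuityZ3.Theorems

open MeasureTheory Set Literature.Probability.LatticeModels Literature.Probability.Percolation

noncomputable section
open Classical

variable {n : ℕ}

/-- **E-form for any three distinct relays** (from the OR-lemma): choose the worst relay and apply
`additiveGluing_threeRelays_of_regionCert`. [cite: KozmaNitzan2024, Theorem 2 (§3.2, pp. 8–9)] -/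
theorem threeRelays_eform_of_orLemma
    (hcert : ∀ (n : ℕ) (w : Sym2 (Fin n) → unitInterval) (o b a₁ a₂ a₃ : Fin n),
      a₁ ≠ a₂ → a₁ ≠ a₃ → a₂ ≠ a₃ →
      (prodBernoulli w).real (openConn a₃ b) ≤ (prodBernoulli w).real (openConn a₁ b) →
      (prodBernoulli w).real (openConn a₃ b) ≤ (prodBernoulli w).real (openConn a₂ b) →
      (prodBernoulli w).real (openConn o b) < (prodBernoulli w).real (openConn a₃ b) →
      (prodBernoulli w).real ((openConn a₁ a₃)ᶜ ∩ (openConn a₂ a₃)ᶜ ∩ (openConn a₁ b ∩ openConn a₂ b)) <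
        (prodBernoulli w).real ((openConn a₁ a₃)ᶜ ∩ (openConn a₂ a₃)ᶜ ∩ openConn a₃ b) →
      (prodBernoulli w).real (openConn o a₂ ∩ (openConn o a₁)ᶜ ∩ (openConn o b)ᶜ ∩ openConn a₃ b) ≤
          (prodBernoulli w).real (openConn o b ∩ openConn a₂ b ∩ (openConn a₁ b)ᶜ ∩ (openConn a₃ b)ᶜ) +
            (prodBernoulli w).real
              ((openConn o a₁ ∪ openConn o a₂ ∪ openConn o a₃)ᶜ ∩ (openConn a₃ b)ᶜ : Set (BondConfig (Fin n))) ∨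
        (prodBernoulli w).real (openConn o a₁ ∩ (openConn o a₂)ᶜ ∩ (openConn o b)ᶜ ∩ openConn a₃ b) ≤
          (prodBernoulli w).real (openConn o b ∩ openConn a₁ b ∩ (openConn a₂ b)ᶜ ∩ (openConn a₃ b)ᶜ) +
            (prodBernoulli w).real
              ((openConn o a₁ ∪ openConn o a₂ ∪ openConn o a₃)ᶜ ∩ (openConn a₃ b)ᶜ : Set (BondConfig (Fin n)))) :
    ∀ (n : ℕ) (w : Sym2 (Fin n) → unitInterval) (o b x y z : Fin n) (t : ℝ),
      x ≠ y → x ≠ z → y ≠ z →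
      1 - t ≤ (prodBernoulli w).real (openConn x b) →
      1 - t ≤ (prodBernoulli w).real (openConn y b) →
      1 - t ≤ (prodBernoulli w).real (openConn z b) →
      (prodBernoulli w).real ((openConn o x ∪ openConn o y ∪ openConn o z) \ openConn o b) ≤ t := by
  intro n w o b x y z t hxy hxz hyz hx hy hz
  have T := additiveGluing_threeRelays_of_orLemma hcert
  by_cases h1 : (prodBernoulli w).real (openConn z b) ≤ (prodBernoulli w).real (openConn x b)
  · by_cases h2 : (prodBernoulli w).real (openConn z b) ≤ (prodBernoulli w).real (openConn y b)
    · -- `z` worst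
      exact T n w o b x y z t hxy hxz hyz hz h1 h2
    · -- `y` worst
      push Not at h2
      have h := T n w o b x z y t hxz hxy hyz.symm hy (h2.le.trans h1) h2.le
      rwa [threeRelays_union_swap] at h
  · push Not at h1
    by_cases h3 : (prodBernoulli w).real (openConn x b) ≤ (prodBernoulli w).real (openConn y b)
    · -- `x` worst
      have h := T n w o b y z x t hyz hxy.symm hxz.symm hx h3 h1.le
      rwa [threeRelays_union_rotate] at h
    · -- `y` worst
      push Not at h3
      have h := T n w o b x z y t hxz hxy hyz.symm hy h3.le (h3.le.trans h1.le)
      rwa [threeRelays_union_swap] at h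

/-- **`AdditiveGluing` for at most three relays besides the target, from the OR-lemma.**  For every weighted graph,
every relay set `A` with `(A.erase b).card ≤ 3`, every `o, b` and `t ≥ 0` with `μ(a ↔ b) ≥ 1 − t` on `A`:
`μ(o ↔ A) − t ≤ μ(o ↔ b)`.  Cases: `o ∈ A` (trivial); `(A.erase b).card ≤ 2` (landed: `additiveGluing_of_card_le_two` if `b ∉ A`,
`stub_goodCardLeThree_k42` if `b ∈ A`); three relays besides `b`: `threeRelays_eform_of_orLemma` and
`{o ↔ A} ⊆ {o ↔ b} ∪ ({o↔x ∪ o↔y ∪ o↔z} ∖ {o ↔ b})`. [cite: KozmaNitzan2024, Conjecture 1 (p. 3), Theorem 2 (§3.2, pp. 8–9)] -/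
theorem additiveGluing_of_erase_card_le_three_of_orLemma
    (hcert : ∀ (n : ℕ) (w : Sym2 (Fin n) → unitInterval) (o b a₁ a₂ a₃ : Fin n),
      a₁ ≠ a₂ → a₁ ≠ a₃ → a₂ ≠ a₃ →
      (prodBernoulli w).real (openConn a₃ b) ≤ (prodBernoulli w).real (openConn a₁ b) →
      (prodBernoulli w).real (openConn a₃ b) ≤ (prodBernoulli w).real (openConn a₂ b) →
      (prodBernoulli w).real (openConn o b) < (prodBernoulli w).real (openConn a₃ b) →
      (prodBernoulli w).real ((openConn a₁ a₃)ᶜ ∩ (openConn a₂ a₃)ᶜ ∩ (openConn a₁ b ∩ openConn a₂ b)) <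
        (prodBernoulli w).real ((openConn a₁ a₃)ᶜ ∩ (openConn a₂ a₃)ᶜ ∩ openConn a₃ b) →
      (prodBernoulli w).real (openConn o a₂ ∩ (openConn o a₁)ᶜ ∩ (openConn o b)ᶜ ∩ openConn a₃ b) ≤
          (prodBernoulli w).real (openConn o b ∩ openConn a₂ b ∩ (openConn a₁ b)ᶜ ∩ (openConn a₃ b)ᶜ) +
            (prodBernoulli w).real
              ((openConn o a₁ ∪ openConn o a₂ ∪ openConn o a₃)ᶜ ∩ (openConn a₃ b)ᶜ : Set (BondConfig (Fin n))) ∨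
        (prodBernoulli w).real (openConn o a₁ ∩ (openConn o a₂)ᶜ ∩ (openConn o b)ᶜ ∩ openConn a₃ b) ≤
          (prodBernoulli w).real (openConn o b ∩ openConn a₁ b ∩ (openConn a₂ b)ᶜ ∩ (openConn a₃ b)ᶜ) +
            (prodBernoulli w).real
              ((openConn o a₁ ∪ openConn o a₂ ∪ openConn o a₃)ᶜ ∩ (openConn a₃ b)ᶜ : Set (BondConfig (Fin n)))) :
    ∀ (n : ℕ) (w : Sym2 (Fin n) → unitInterval) (A : Finset (Fin n)) (o b : Fin n) (t : ℝ),
      (A.erase b).card ≤ 3 → 0 ≤ t →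
      (∀ a ∈ A, 1 - t ≤ (prodBernoulli w).real (openConn a b)) →
      (prodBernoulli w).real (⋃ a ∈ A, openConn o a) - t ≤ (prodBernoulli w).real (openConn o b) := by
  intro n w A o b t hcard ht hrel
  have hm : ∀ s : Set (BondConfig (Fin n)), MeasurableSet s := fun _ => MeasurableSet.of_discrete
  have hU1 : (prodBernoulli w).real (⋃ a ∈ A, (openConn o a : Set (BondConfig (Fin n)))) ≤ 1 := measureReal_le_one
  -- `o ∈ A`: trivial
  by_cases hoA : o ∈ A
  · have h := hrel o hoA
    have hoo : (prodBernoulli w).real (openConn o b : Set (BondConfig (Fin n))) =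
        (prodBernoulli w).real (openConn o b : Set (BondConfig (Fin n))) := rfl
    linarith
  by_cases hsmall : (A.erase b).card ≤ 2
  · by_cases hbA : b ∈ A
    · -- `b ∈ A`, at most two further relays: the landed two-relay goodness kernel
      have hA3 : A.card ≤ 3 := by
        have := Finset.card_erase_of_mem hbA; omega
      have hK := stub_goodCardLeThree_k42 n w A o b hbA hoA hA3 t (fun _ => b) (fun _ => hbA) hrel
      have hP : 0 ≤ ∑ W ∈ (Finset.univ : Finset (Finset (Fin n))).filter (fun W => o ∈ W ∧ Disjoint W A),
          (prodBernoulli w).real {ω : BondConfig (Fin n) | openCluster ω o = (W : Set (Fin n))} *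
            (prodBernoulli w).real (openConnIn ((W : Set (Fin n))ᶜ) b b)ᶜ :=
        Finset.sum_nonneg fun W _ => mul_nonneg measureReal_nonneg measureReal_nonneg
      have h1 := measureReal_inter_add_sdiff (μ := prodBernoulli w) (s := ⋃ a ∈ A, openConn o a) (hm (openConn o b))
        (h := measure_ne_top _ _)
      have h2 : (prodBernoulli w).real ((⋃ a ∈ A, openConn o a) ∩ openConn o b) ≤
          (prodBernoulli w).real (openConn o b : Set (BondConfig (Fin n))) := measureReal_mono Set.inter_subset_right
      have h3 : ((⋃ a ∈ A, openConn o a) \ openConn o b : Set (BondConfig (Fin n))) =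
          (⋃ a ∈ A, openConn o a) ∩ (openConn o b)ᶜ := Set.sdiff_eq _ _
      rw [h3] at h1
      linarith
    · -- `b ∉ A`: `A.card ≤ 2`, the landed two-relay additive gluing
      have hA2 : A.card ≤ 2 := by rwa [Finset.erase_eq_of_notMem hbA] at hsmall
      exact additiveGluing_of_card_le_two n w A o b t hA2 ht hrel
  · -- exactly three relays besides `b`
    have h3 : (A.erase b).card = 3 := by omega
    obtain ⟨x, y, z, hxy, hxz, hyz, hE⟩ := Finset.card_eq_three.1 h3
    have hxA : x ∈ A := Finset.mem_of_mem_erase (by rw [hE]; simp)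
    have hyA : y ∈ A := Finset.mem_of_mem_erase (by rw [hE]; simp)
    have hzA : z ∈ A := Finset.mem_of_mem_erase (by rw [hE]; simp)
    have hT := threeRelays_eform_of_orLemma hcert n w o b x y z t hxy hxz hyz (hrel x hxA) (hrel y hyA) (hrel z hzA)
    -- `{o ↔ A} ⊆ {o ↔ b} ∪ ({o↔x ∪ o↔y ∪ o↔z} ∖ {o ↔ b})`
    have hsub : (⋃ a ∈ A, (openConn o a : Set (BondConfig (Fin n)))) ⊆
        openConn o b ∪ ((openConn o x ∪ openConn o y ∪ openConn o z) \ openConn o b) := by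
      intro ω hω
      simp only [Set.mem_iUnion] at hω
      obtain ⟨a, haA, ha⟩ := hω
      by_cases hob : ω ∈ (openConn o b : Set (BondConfig (Fin n)))
      · exact Or.inl hob
      · right
        refine ⟨?_, hob⟩
        have hab : a ≠ b := by
          rintro rfl; exact hob ha
        have haE : a ∈ A.erase b := Finset.mem_erase.2 ⟨hab, haA⟩
        rw [hE] at haE
        simp only [Finset.mem_insert, Finset.mem_singleton] at haE
        rcases haE with rfl | rfl | rfl
        · exact Or.inl (Or.inl ha)
        · exact Or.inl (Or.inr ha)
        · exact Or.inr ha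
    have hle := (measureReal_mono hsub (measure_ne_top _ _)).trans
      (measureReal_union_le (μ := prodBernoulli w) (openConn o b)
        ((openConn o x ∪ openConn o y ∪ openConn o z) \ openConn o b))
    linarith

end

end Summit.CriticalPhenomena.PercolationContinuityZ3.Theorems
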